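import Literature.NumberTheory.Sieve.DeshouillersIwaniecLargeSieveMaass
import Literature.NumberTheory.Sieve.DeshouillersIwaniecLargeSieveHolSpec
import Literature.NumberTheory.Sieve.BombieriFriedlanderIwaniecKuznetsovBoundFromSpectral
import HarnessLib

/-!
# The Maass / Eisenstein large-sieve hypotheses of the Kuznetsov package from Kuznetsov's formula

The tree's reduction `BFI.L1.…Theorem1_of_kuznetsov` (file `…KuznetsovBoundFromSpectral`) of the
Bombieri–Friedlander–Iwaniec theorem takes, among its eleven hypotheses on abstract spectral data
`D : ℕ → BFI.L1.SpecData`, the four large sieve inequalities `LSMaassInf D`, `LSMaassZero D`,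
`LSEisInf D`, `LSEisZero D` ([DeshouillersIwaniec1982, Theorem 2 (1.29)–(1.30)];
[Drappeau2017, Prop. 4.7 (4.20)–(4.21)]).  Here all four are DERIVED from KUZNETSOV'S FORMULA
[Iwaniec2002, Theorem 9.3 (9.12)] at the respective cusp for the Gaussian test functions `h_K` — the
hypotheses `KuzGaussInf D`, `KuzGaussZero D` (the predicate `DeshouillersIwaniec.KuzGaussFamily` of
`…LargeSieveMaass` for the arrays `P, Pe, PE`, resp. `Q(s·), Qe(s·), QE(s·)`, `s = ±1`) — by
`DeshouillersIwaniec.largeSieve_maass_eis` (D–I's proof of §5.3 with Proposition 3).  Nothing else is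
assumed.  Together with `…LargeSieveHolSpec` this replaces the six large sieve hypotheses of
`BombieriFriedlanderIwaniecTheorem1_of_kuznetsov` by four summation formulas
(`BombieriFriedlanderIwaniecTheorem1_of_formulas`, `…Theorem10_of_formulas`).

## References
* [DeshouillersIwaniec1982] J.-M. Deshouillers, H. Iwaniec, *Kloosterman sums and Fourier coefficients
  of cusp forms*, Invent. Math. 70 (1982): Theorem 2 (1.29)–(1.30); §5.3.
* [Iwaniec2002] H. Iwaniec, *Spectral methods of automorphic forms*, 2nd ed., GSM 53: Theorem 9.3.
* [Drappeau2017] S. Drappeau, *Sums of Kloosterman sums in arithmetic progressions, and the error term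
  in the dispersion method*, Proc. LMS 114 (2017): Prop. 4.7 (4.20)–(4.21).
* [BombieriFriedlanderIwaniecActa1986] E. Bombieri, J. B. Friedlander, H. Iwaniec, *Primes in arithmetic
  progressions to large moduli*, Acta Math. 156 (1986): §8 Theorem 1, Theorem 10.
-/

noncomputable section

open Real MeasureTheory

namespace Literature.NumberTheory.Sieve


namespace BFI.L1

open DeshouillersIwaniec Finset

/-- **Hypothesis (K∞G): Kuznetsov's formula [Iwaniec2002, Theorem 9.3 (9.12)] at the cusp `∞` of `Γ₀(r)`
for the Gaussian test functions `h_K(t) = πt coth(πt) e^{−t²/K²}` (`K ≥ 1`)** for the Maass /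
exceptional / Eisenstein arrays `P`, `Pe`, `PE` of `D r`, every level `r ≥ 1` (the predicate
`DeshouillersIwaniec.KuzGaussFamily`: the formula divided by `4π`, diagonal `δ_{mn} h₀/(4π)`,
Kloosterman side `Σ_{c ≡ 0 (r)} (4πc)⁻¹ S(m,n;c) h_K⁺(4π√(mn)/c)`).
[cite: Iwaniec2002, Theorem 9.3 (9.12); DeshouillersIwaniec1982, Theorem 1, §5.3 p. 260] -/
def KuzGaussInf (D : ℕ → SpecData) : Prop :=
  ∀ r : ℕ, 1 ≤ r → KuzGaussFamily (D r).ι (D r).t (D r).P (D r).ιe (D r).y (D r).Pe (D r).nc (D r).PE r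

/-- **Hypothesis (K0G): Kuznetsov's formula [Iwaniec2002, Theorem 9.3 (9.12)] at the cusp `0` of `Γ₀(r)`
(Iwaniec's scaling `σ₀ = (0, −1/√r; √r, 0)`, `σ₀⁻¹Γ₀(r)σ₀ = Γ₀(r)`, `S₀₀(m,n;c) = S(m,n;c)` with
`c ≡ 0 (mod r)`), for both signs `s = ±1`** (arrays `n ↦ Q f (sn)`, `Qe f (sn)`, `QE 𝔠 t (sn)`; for
`s = −1` this is (9.12) with `m, n` both negative, `mn > 0`), every `r ≥ 1`.
[cite: Iwaniec2002, Theorem 9.3 (9.12); DeshouillersIwaniec1982, Theorem 1, §5.3 p. 260] -/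
def KuzGaussZero (D : ℕ → SpecData) : Prop :=
  ∀ r : ℕ, 1 ≤ r → ∀ s : ℤ, (s = 1 ∨ s = -1) →
    KuzGaussFamily (D r).ι (D r).t (fun f n => (D r).Q f (s * n)) (D r).ιe (D r).y (fun f n => (D r).Qe f (s * n))
      (D r).nc (fun 𝔠 t n => (D r).QE 𝔠 t (s * n)) r

/-- **`LSMaassInf` from Kuznetsov's formula at `∞`** [DeshouillersIwaniec1982, Theorem 2 (1.29)].
[cite: DeshouillersIwaniec1982, Theorem 2 (1.29), §5.3] -/
theorem lsMaassInf_of_kuzGauss {D : ℕ → SpecData} (h : KuzGaussInf D) : LSMaassInf D := by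
  intro ε hε
  obtain ⟨Kc, hKc0, hKc⟩ := largeSieve_maass_eis hε
  refine ⟨Kc, hKc0, fun r hr T N hT hN a F hF Fe => ?_⟩
  exact (hKc (D r).ι (D r).t (D r).P (D r).ιe (D r).y (D r).Pe (D r).nc (D r).PE r hr (h r hr) T N hT hN a).1 F Fe hF

/-- **`LSEisInf` from Kuznetsov's formula at `∞`** [DeshouillersIwaniec1982, Theorem 2 (1.30)].
[cite: DeshouillersIwaniec1982, Theorem 2 (1.30), §5.3] -/
theorem lsEisInf_of_kuzGauss {D : ℕ → SpecData} (h : KuzGaussInf D) : LSEisInf D := by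
  intro ε hε
  obtain ⟨Kc, hKc0, hKc⟩ := largeSieve_maass_eis hε
  refine ⟨Kc, hKc0, fun r hr T N hT hN a => ?_⟩
  exact (hKc (D r).ι (D r).t (D r).P (D r).ιe (D r).y (D r).Pe (D r).nc (D r).PE r hr (h r hr) T N hT hN a).2

/-- **`LSMaassZero` from Kuznetsov's formula at `0`** [DeshouillersIwaniec1982, Theorem 2 (1.29)].
[cite: DeshouillersIwaniec1982, Theorem 2 (1.29), §5.3] -/
theorem lsMaassZero_of_kuzGauss {D : ℕ → SpecData} (h : KuzGaussZero D) : LSMaassZero D := by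
  intro ε hε
  obtain ⟨Kc, hKc0, hKc⟩ := largeSieve_maass_eis hε
  refine ⟨Kc, hKc0, fun r hr T N hT hN a s hs F hF Fe => ?_⟩
  exact (hKc (D r).ι (D r).t (fun f n => (D r).Q f (s * n)) (D r).ιe (D r).y (fun f n => (D r).Qe f (s * n))
    (D r).nc (fun 𝔠 t n => (D r).QE 𝔠 t (s * n)) r hr (h r hr s hs) T N hT hN a).1 F Fe hF

/-- **`LSEisZero` from Kuznetsov's formula at `0`** [DeshouillersIwaniec1982, Theorem 2 (1.30)].
[cite: DeshouillersIwaniec1982, Theorem 2 (1.30), §5.3] -/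
theorem lsEisZero_of_kuzGauss {D : ℕ → SpecData} (h : KuzGaussZero D) : LSEisZero D := by
  intro ε hε
  obtain ⟨Kc, hKc0, hKc⟩ := largeSieve_maass_eis hε
  refine ⟨Kc, hKc0, fun r hr T N hT hN a s hs => ?_⟩
  exact (hKc (D r).ι (D r).t (fun f n => (D r).Q f (s * n)) (D r).ιe (D r).y (fun f n => (D r).Qe f (s * n))
    (D r).nc (fun 𝔠 t n => (D r).QE 𝔠 t (s * n)) r hr (h r hr s hs) T N hT hN a).2

end BFI.L1

/-- **BFI 1986, Theorem 1 from the spectral summation formulas.**  The eleven hypotheses of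
`BombieriFriedlanderIwaniecTheorem1_of_kuznetsov` with the six large sieve inequalities
[DeshouillersIwaniec1982, Theorem 2 (1.28)–(1.30)] REPLACED by the summation formulas they follow
from: Petersson's formula at `∞` and `0` (`PetInf`, `PetZero`, file `…LargeSieveHolSpec`) and
Kuznetsov's formula for the Gaussian test functions at `∞` and `0` (`KuzGaussInf`, `KuzGaussZero`).
[cite: BombieriFriedlanderIwaniecActa1986, §8 Theorem 1 p. 225; DeshouillersIwaniec1982, Theorem 2, §5.2–5.3] -/
theorem BombieriFriedlanderIwaniecTheorem1_of_formulas (D : ℕ → BFI.L1.SpecData) (W : BFI.L1.KuzTransforms)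
    (hKp : BFI.L1.KuzPlus D W) (hKm : BFI.L1.KuzMinus D W) (hW : BFI.L1.TransformBound W)
    (hPi : BFI.L1.PetInf D) (hPz : BFI.L1.PetZero D) (hGi : BFI.L1.KuzGaussInf D) (hGz : BFI.L1.KuzGaussZero D)
    (hE5 : BFI.L1.ExcFive D) (hE7 : BFI.L1.ExcSeven D) : BombieriFriedlanderIwaniecTheorem1 :=
  BombieriFriedlanderIwaniecTheorem1_of_kuznetsov D W hKp hKm hW
    (BFI.L1.lsMaassInf_of_kuzGauss hGi) (BFI.L1.lsMaassZero_of_kuzGauss hGz)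
    (BFI.L1.lsEisInf_of_kuzGauss hGi) (BFI.L1.lsEisZero_of_kuzGauss hGz)
    (BFI.L1.lsHolInf_of_petersson hPi) (BFI.L1.lsHolZero_of_petersson hPz) hE5 hE7

/-- **BFI 1986, Theorem 10 from the spectral summation formulas** (same replacement).
[cite: BombieriFriedlanderIwaniecActa1986, Theorem 10 p. 209; DeshouillersIwaniec1982, Theorem 2, §5.2–5.3] -/
theorem BombieriFriedlanderIwaniecTheorem10_of_formulas (D : ℕ → BFI.L1.SpecData) (W : BFI.L1.KuzTransforms)
    (hKp : BFI.L1.KuzPlus D W) (hKm : BFI.L1.KuzMinus D W) (hW : BFI.L1.TransformBound W)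
    (hPi : BFI.L1.PetInf D) (hPz : BFI.L1.PetZero D) (hGi : BFI.L1.KuzGaussInf D) (hGz : BFI.L1.KuzGaussZero D)
    (hE5 : BFI.L1.ExcFive D) (hE7 : BFI.L1.ExcSeven D) : BombieriFriedlanderIwaniecTheorem10 :=
  BombieriFriedlanderIwaniecTheorem10_of_kuznetsov D W hKp hKm hW
    (BFI.L1.lsMaassInf_of_kuzGauss hGi) (BFI.L1.lsMaassZero_of_kuzGauss hGz)
    (BFI.L1.lsEisInf_of_kuzGauss hGi) (BFI.L1.lsEisZero_of_kuzGauss hGz)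
    (BFI.L1.lsHolInf_of_petersson hPi) (BFI.L1.lsHolZero_of_petersson hPz) hE5 hE7

end Literature.NumberTheory.Sieve
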